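import Literature.Topology.FourManifolds.ExoticAnnulus
import Literature.Topology.FourManifolds.SPC4Wave0SmoothingDimOne
import HarnessLib

/-!
# Every topological surface admits a smooth structure (Radó 1925)

Topic `Literature/Topology/FourManifolds`; the `n = 2` leaf of the named fact
`Literature.Topology.FourManifolds.exists_chartedSpace_isManifold_of_le_three` (spc4.S33;
A. Juhász, *Differential and Low-Dimensional Topology* (2023), Thm. 1.33, existence half:
"every topological `n`-manifold, `n ≤ 3`, admits a smooth structure"). Classically the case
`n = 2` is T. Radó's theorem (*Über den Begriff der Riemannschen Fläche*, Acta Sci. Math. Szeged 2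
(1925): surfaces are triangulable) followed by smoothing of PL surfaces; E. E. Moise,
*Geometric topology in dimensions 2 and 3*, GTM 47 (1977), Ch. 8; A. Hatcher, *The Kirby torus
trick for surfaces*, arXiv:1312.3518 (2013), Thm. A ("Every topological surface has a smooth
structure"), whose chart-by-chart strategy is followed here with the torus trick replaced by the
two-dimensional annulus theorem and Morse theory on the exotic annulus
(`PlanarSmoothStructures.lean`, `PlanarSeams.lean`, `ExoticAnnulus.lean`):

* `SurfaceSmoothing.GoodChart`, `exists_goodChart` — topological charts of the surface valued in
  `ℂ` whose target contains the closed disc of radius `4`, at every point, inside any open set;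
* `SurfaceSmoothing.exists_seq_goodChart` — a sequence of good charts (indexed by `ℕ`, with
  gaps) whose unit discs cover the surface and whose discs of radius `4` form a locally finite
  family (compact exhaustion: second countable + locally compact);
* `SurfaceSmoothing.step`, `stage` — **the induction**: a smooth atlas (`AtlasOn` of the smooth
  plane groupoid on an open part of the surface) containing the unit discs of the charts already
  treated is extended over the unit disc of the next chart and modified only inside its disc of
  radius `3` — read in the chart, this is the seam lemma `exists_planeAtlas_seam`; `stage_agreeOn`
  — the stages stabilise on every open set avoiding the later modified regions;
* `SurfaceSmoothing.exists_atlasOn_univ` — by local finiteness the stages are locally eventually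
  constant and glue to a smooth atlas on the whole surface (`AtlasOn.limit`);
* `exists_chartedSpace_isManifold_two` — **every Hausdorff second countable topological surface
  admits a `C^∞` structure**, in the exact shape of the `n = 2` case of the named fact;
* `exists_chartedSpace_isManifold_of_le_three_of_three` — consequently the named fact reduces to
  its case `n = 3` alone (Moise's theorem, 1952), via the tree's
  `exists_chartedSpace_isManifold_of_le_three_of_two_three`.

Everything is proved; no named facts are introduced.

## References

* T. Radó, *Über den Begriff der Riemannschen Fläche*, Acta Sci. Math. (Szeged) 2 (1925) 101–121.
* E. E. Moise, *Geometric topology in dimensions 2 and 3*, GTM 47 (1977), Ch. 8.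
* A. Hatcher, *The Kirby torus trick for surfaces*, arXiv:1312.3518 (2013), Thm. A.
* A. Juhász, *Differential and Low-Dimensional Topology*, LMS Student Texts 104 (2023),
  Thm. 1.33. [Juhasz2023]
-/


noncomputable section

namespace Literature.Topology.FourManifolds

open _root_.Set _root_.Metric _root_.OpenPartialHomeomorph _root_.Filter
open scoped _root_.Manifold _root_.Topology _root_.ContDiff
open Literature.Geometry.Manifold (AtlasOn)
open Literature.Geometry.Manifold.AtlasOn

/-- Local notation for the model plane `ℝ²`. -/
local notation "𝔼₂" => EuclideanSpace ℝ (Fin 2)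

namespace SurfaceSmoothing

universe u

variable {M : Type u} [TopologicalSpace M]

/-! ### Good topological charts -/

/-- A **good chart** of a topological surface: a `ℂ`-valued topological chart whose target
contains the closed disc of radius `4` (so that the discs of radii `1, 2, 3` of the seam lemma
are available in it). [folklore] -/
structure GoodChart (M : Type u) [TopologicalSpace M] where
  /-- The chart. -/
  φ : OpenPartialHomeomorph M ℂ
  /-- Its target contains the closed disc of radius `4`. -/
  closedBall_subset : closedBall (0 : ℂ) 4 ⊆ φ.target

namespace GoodChart

variable (c : GoodChart M)

/-- The preimage of the closed disc of radius `r ≤ 4`. [folklore] -/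
def disc (r : ℝ) : Set M := c.φ.symm '' closedBall 0 r

/-- The **inner set** of a good chart: the preimage of the open unit disc. [folklore] -/
def inner : Set M := c.φ.source ∩ c.φ ⁻¹' ball 0 1

/-- For `r ≤ 4` the disc is the part of the source over the closed disc. [folklore] -/
theorem disc_eq {r : ℝ} (hr : r ≤ 4) : c.disc r = c.φ.source ∩ c.φ ⁻¹' closedBall 0 r :=
  c.φ.symm_image_eq_source_inter_preimage ((closedBall_subset_closedBall hr).trans c.closedBall_subset)

/-- Membership in a disc (`r ≤ 4`). [folklore] -/
theorem mem_disc_iff {r : ℝ} (hr : r ≤ 4) {y : M} : y ∈ c.disc r ↔ y ∈ c.φ.source ∧ c.φ y ∈ closedBall (0 : ℂ) r := by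
  rw [c.disc_eq hr]; rfl

/-- The discs are compact (`r ≤ 4`). [folklore] -/
theorem isCompact_disc {r : ℝ} (hr : r ≤ 4) : IsCompact (c.disc r) :=
  (isCompact_closedBall (0 : ℂ) r).image_of_continuousOn
    (c.φ.continuousOn_symm.mono ((closedBall_subset_closedBall hr).trans c.closedBall_subset))

/-- The discs are closed (`r ≤ 4`, Hausdorff surface). [folklore] -/
theorem isClosed_disc [T2Space M] {r : ℝ} (hr : r ≤ 4) : IsClosed (c.disc r) := (c.isCompact_disc hr).isClosed

/-- The discs are monotone in the radius (`s ≤ 4`). [folklore] -/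
theorem disc_mono {r s : ℝ} (hrs : r ≤ s) (hs : s ≤ 4) : c.disc r ⊆ c.disc s := by
  rw [c.disc_eq (hrs.trans hs), c.disc_eq hs]
  exact fun y hy => ⟨hy.1, closedBall_subset_closedBall hrs hy.2⟩

/-- The inner set is open. [folklore] -/
theorem isOpen_inner : IsOpen c.inner := c.φ.isOpen_inter_preimage isOpen_ball

/-- The inner set lies in the unit disc. [folklore] -/
theorem inner_subset_disc_one : c.inner ⊆ c.disc 1 := by
  rw [c.disc_eq (by norm_num)]; exact fun y hy => ⟨hy.1, ball_subset_closedBall hy.2⟩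

/-- The discs lie in the source. [folklore] -/
theorem disc_subset_source {r : ℝ} (hr : r ≤ 4) : c.disc r ⊆ c.φ.source := by
  rw [c.disc_eq hr]; exact inter_subset_left

/-- Points of the source outside the disc of radius `r ≤ 4` map outside the closed disc.
[folklore] -/
theorem notMem_closedBall_of_notMem_disc {r : ℝ} (hr : r ≤ 4) {y : M} (hy : y ∈ c.φ.source) (hyd : y ∉ c.disc r) :
    c.φ y ∉ closedBall (0 : ℂ) r := fun h => hyd ((c.mem_disc_iff hr).2 ⟨hy, h⟩)

end GoodChart

/-- The real-linear identification `ℂ ≅ ℝ²` as a homeomorphism. [folklore] -/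
def cιHomeo : ℂ ≃ₜ 𝔼₂ := cι.toHomeomorph

/-- **Good charts exist at every point, inside any open neighbourhood**: rescale a chart of the
topological atlas (read in `ℂ` through `cι`) so that a small closed coordinate disc inside the
neighbourhood becomes the closed disc of radius `4`. [folklore] -/
theorem exists_goodChart [ChartedSpace 𝔼₂ M] {x : M} {O : Set M} (hO : IsOpen O) (hx : x ∈ O) :
    ∃ c : GoodChart M, x ∈ c.inner ∧ c.disc 4 ⊆ O := by
  -- the chart at `x`, read in `ℂ`
  set ψ : OpenPartialHomeomorph M ℂ := (chartAt 𝔼₂ x).trans cιHomeo.symm.toOpenPartialHomeomorph with hψ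
  have hxψ : x ∈ ψ.source := by
    rw [hψ, trans_source, Homeomorph.toOpenPartialHomeomorph_source, preimage_univ, inter_univ]
    exact mem_chart_source 𝔼₂ x
  set p : ℂ := ψ x with hp
  -- a closed coordinate disc around `p` inside `ψ.target ∩ ψ⁻¹ O`
  have hnhds : ψ.target ∩ ψ.symm ⁻¹' O ∈ 𝓝 p := by
    refine (ψ.isOpen_inter_preimage_symm hO).mem_nhds ⟨ψ.map_source hxψ, ?_⟩
    show ψ.symm (ψ x) ∈ O
    rw [ψ.left_inv hxψ]; exact hx
  obtain ⟨r, hr, hball⟩ := Metric.mem_nhds_iff.1 hnhds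
  have hcb : closedBall p (r / 2) ⊆ ψ.target ∩ ψ.symm ⁻¹' O := (closedBall_subset_ball (half_lt_self hr)).trans hball
  -- the affine rescaling `z ↦ (8 / r) (z - p)`, carrying `closedBall p (r/2)` onto `closedBall 0 4`
  set k : ℝ := 8 / r with hk
  have hkpos : 0 < k := by positivity
  set A : ℂ ≃ₜ ℂ := (Homeomorph.addRight (-p)).trans (Homeomorph.smulOfNeZero (k : ℂ) (by exact_mod_cast hkpos.ne')) with hA
  have hA_apply : ∀ z, A z = (k : ℂ) * (z + -p) := fun z => by simp [hA, smul_eq_mul]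
  have hkC : (k : ℂ) ≠ 0 := by exact_mod_cast hkpos.ne'
  have hA_symm : ∀ w, A.symm w = (k : ℂ)⁻¹ * w + p := fun w => by
    apply A.injective
    rw [A.apply_symm_apply, hA_apply]
    field_simp
    ring
  have hA_symm_mem : ∀ w, ‖w‖ ≤ 4 → A.symm w ∈ closedBall p (r / 2) := fun w hw => by
    rw [mem_closedBall, dist_eq_norm]
    have h2 : A.symm w - p = (k : ℂ)⁻¹ * w := by rw [hA_symm]; ring
    rw [h2, norm_mul, norm_inv, Complex.norm_real, Real.norm_eq_abs, abs_of_pos hkpos, hk]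
    rw [inv_div]
    have : r / 8 * ‖w‖ ≤ r / 8 * 4 := by apply mul_le_mul_of_nonneg_left hw; positivity
    linarith
  set φ : OpenPartialHomeomorph M ℂ := ψ.trans A.toOpenPartialHomeomorph with hφ
  have hφsrc : φ.source = ψ.source := by
    rw [hφ, trans_source, Homeomorph.toOpenPartialHomeomorph_source, preimage_univ, inter_univ]
  have hφtgt : φ.target = A '' ψ.target := by
    rw [hφ, trans_target, Homeomorph.toOpenPartialHomeomorph_target, univ_inter]
    ext w; constructor
    · intro hw; exact ⟨A.symm w, hw, A.apply_symm_apply w⟩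
    · rintro ⟨z, hz, rfl⟩; show A.symm (A z) ∈ ψ.target; rw [A.symm_apply_apply]; exact hz
  have hφ_apply : ∀ y, φ y = A (ψ y) := fun y => rfl
  have hcb4 : closedBall (0 : ℂ) 4 ⊆ φ.target := fun w hw => by
    rw [hφtgt]
    exact ⟨A.symm w, (hcb (hA_symm_mem w (mem_closedBall_zero_iff.1 hw))).1, A.apply_symm_apply w⟩
  refine ⟨⟨φ, hcb4⟩, ?_, ?_⟩
  · show x ∈ φ.source ∩ φ ⁻¹' ball 0 1
    refine ⟨by rw [hφsrc]; exact hxψ, ?_⟩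
    show φ x ∈ ball (0 : ℂ) 1
    rw [hφ_apply, ← hp, hA_apply, add_neg_cancel, mul_zero]
    exact mem_ball_self one_pos
  · intro y hy
    rw [GoodChart.mem_disc_iff _ le_rfl] at hy
    obtain ⟨hys, hyb⟩ := hy
    have h1 : ψ y = A.symm (φ y) := by rw [hφ_apply, A.symm_apply_apply]
    have h2 : ψ y ∈ closedBall p (r / 2) := by rw [h1]; exact hA_symm_mem _ (mem_closedBall_zero_iff.1 hyb)
    have h3 := (hcb h2).2
    rw [mem_preimage, ψ.left_inv (hφsrc ▸ hys)] at h3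
    exact h3

/-! ### A locally finite sequence of good charts whose inner sets cover the surface -/

section Family

variable [T2Space M] [SecondCountableTopology M] [ChartedSpace 𝔼₂ M]

omit [T2Space M] [SecondCountableTopology M] in
/-- A topological surface is locally compact. [folklore] -/
theorem locallyCompactSpace : LocallyCompactSpace M := ChartedSpace.locallyCompactSpace 𝔼₂ M

omit [T2Space M] in
/-- A topological surface is σ-compact. [folklore] -/
theorem sigmaCompactSpace : SigmaCompactSpace M := by
  haveI := locallyCompactSpace (M := M); exact sigmaCompactSpace_of_locallyCompact_secondCountable

/-- **A locally finite sequence of good charts whose inner sets cover** (indexed by `ℕ`, with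
gaps `none`): the shells of a compact exhaustion are covered by finitely many good charts whose
big discs lie in slightly larger open shells; the countable family is injected into `ℕ`.
[folklore] -/
theorem exists_seq_goodChart : ∃ c : ℕ → Option (GoodChart M),
    (∀ y : M, ∃ k g, c k = some g ∧ y ∈ g.inner) ∧
    LocallyFinite (fun k => ((c k).map fun g => g.disc 4).getD ∅) := by
  classical
  rcases isEmpty_or_nonempty M with hM | hM
  · exact ⟨fun _ => none, fun y => (hM.false y).elim, fun y => (hM.false y).elim⟩
  haveI : Nonempty (GoodChart M) := by
    obtain ⟨x₀⟩ := hM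
    obtain ⟨g, -⟩ := exists_goodChart (M := M) isOpen_univ (mem_univ x₀)
    exact ⟨g⟩
  haveI := locallyCompactSpace (M := M)
  haveI := sigmaCompactSpace (M := M)
  set K := CompactExhaustion.choice M with hK
  -- compact shells `S n` inside open shells `O n`
  set S : ℕ → Set M := fun n => K (n + 1) \ (if n = 0 then ∅ else interior (K n)) with hS
  set O : ℕ → Set M := fun n => interior (K (n + 2)) \ (if n = 0 then ∅ else K (n - 1)) with hO
  have hSc : ∀ n, IsCompact (S n) := fun n => by
    simp only [hS]; split_ifs
    · rw [Set.sdiff_empty]; exact K.isCompact (n + 1)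
    · exact (K.isCompact _).diff isOpen_interior
  have hOo : ∀ n, IsOpen (O n) := fun n => by
    simp only [hO]; split_ifs
    · rw [Set.sdiff_empty]; exact isOpen_interior
    · exact isOpen_interior.sdiff (K.isClosed _)
  have hSO : ∀ n, S n ⊆ O n := by
    intro n y hy
    simp only [hS, hO, Set.mem_sdiff] at hy ⊢
    refine ⟨interior_mono (K.subset (by omega)) (K.subset_interior_succ _ hy.1), ?_⟩
    split_ifs with h
    · exact notMem_empty _
    · rw [if_neg h] at hy
      intro h'
      have h1 : K (n - 1) ⊆ interior (K n) := by
        have := K.subset_interior_succ (n - 1)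
        rwa [show n - 1 + 1 = n by omega] at this
      exact hy.2 (h1 h')
  have hcover : ∀ y : M, ∃ n, y ∈ S n := by
    intro y
    have hex : ∃ n, y ∈ K (n + 1) := by
      obtain ⟨m, hm⟩ := K.exists_mem y
      exact ⟨m, K.subset (by omega) hm⟩
    refine ⟨Nat.find hex, ?_⟩
    simp only [hS, Set.mem_sdiff]
    refine ⟨Nat.find_spec hex, ?_⟩
    split_ifs with h
    · exact notMem_empty _
    · intro h'
      have hmin := Nat.find_min hex (show Nat.find hex - 1 < Nat.find hex by omega)
      apply hmin
      rw [show Nat.find hex - 1 + 1 = Nat.find hex by omega]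
      exact interior_subset h'
  -- good charts at the points of the shells, finite subcovers
  have hchart : ∀ n, ∀ y ∈ S n, ∃ g : GoodChart M, y ∈ g.inner ∧ g.disc 4 ⊆ O n := fun n y hy =>
    exists_goodChart (hOo n) (hSO n hy)
  choose! g hg using hchart
  have hfin : ∀ n, ∃ t : Finset M, ↑t ⊆ S n ∧ S n ⊆ ⋃ y ∈ t, (g n y).inner := by
    intro n
    obtain ⟨t, ht, hcov⟩ := (hSc n).elim_nhds_subcover (fun y => (g n y).inner)
      fun y hy => ((g n y).isOpen_inner).mem_nhds (hg n y hy).1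
    exact ⟨t, ht, hcov⟩
  choose t ht htcov using hfin
  -- the countable index set and its injection into `ℕ`
  set α := Σ n : ℕ, ↥(t n) with hα
  obtain ⟨ι, hι⟩ := exists_injective_nat α
  set c : ℕ → Option (GoodChart M) :=
    fun k => if h : ∃ a : α, ι a = k then some (g h.choose.1 h.choose.2) else none with hc
  have hc_apply : ∀ a : α, c (ι a) = some (g a.1 a.2) := by
    intro a
    have h : ∃ a' : α, ι a' = ι a := ⟨a, rfl⟩
    simp only [hc, dif_pos h]
    rw [show h.choose = a from hι h.choose_spec]
  have hc_none : ∀ k, (¬ ∃ a : α, ι a = k) → c k = none := fun k hk => by simp only [hc, dif_neg hk]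
  refine ⟨c, fun y => ?_, fun y => ?_⟩
  · obtain ⟨n, hn⟩ := hcover y
    obtain ⟨z, hz, hyz⟩ := mem_iUnion₂.1 (htcov n hn)
    exact ⟨ι ⟨n, ⟨z, hz⟩⟩, g n z, hc_apply ⟨n, ⟨z, hz⟩⟩, hyz⟩
  · -- near `y ∈ K m`, only charts from the shells `n ≤ m + 1` appear
    obtain ⟨m, hm⟩ := K.exists_mem y
    refine ⟨interior (K (m + 1)), isOpen_interior.mem_nhds (K.subset_interior_succ _ hm), ?_⟩
    have hfinα : {a : α | a.1 ≤ m + 1}.Finite := by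
      set f : (Σ n : Fin (m + 2), ↥(t n)) → α := fun b => ⟨b.1.1, b.2⟩ with hf
      refine (finite_range f).subset fun a ha => ⟨⟨⟨a.1, by simp only [mem_setOf_eq] at ha; omega⟩, a.2⟩, rfl⟩
    refine (hfinα.image ι).subset fun k hk => ?_
    obtain ⟨w, hw⟩ := hk
    by_cases hex : ∃ a : α, ι a = k
    · obtain ⟨a, rfl⟩ := hex
      refine ⟨a, ?_, rfl⟩
      simp only [hc_apply, Option.map_some, Option.getD_some, mem_inter_iff] at hw
      -- `disc 4 ⊆ O a.1` meets `interior (K (m+1))` only if `a.1 ≤ m + 1`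
      have hwO : w ∈ O a.1 := (hg a.1 a.2 (ht a.1 a.2.2)).2 hw.1
      simp only [mem_setOf_eq]
      by_contra hlt
      simp only [hO, Set.mem_sdiff] at hwO
      rw [if_neg (by omega)] at hwO
      exact hwO.2 (K.subset (by omega) (interior_subset hw.2))
    · simp [hc_none k hex] at hw

end Family

end SurfaceSmoothing

end Literature.Topology.FourManifolds

end


noncomputable section

namespace Literature.Topology.FourManifolds

open _root_.Set _root_.Metric _root_.OpenPartialHomeomorph _root_.Filter
open scoped _root_.Manifold _root_.Topology _root_.ContDiff
open Literature.Geometry.Manifold (AtlasOn)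
open Literature.Geometry.Manifold.AtlasOn

/-- Local notation for the model plane `ℝ²`. -/
local notation "𝔼₂" => EuclideanSpace ℝ (Fin 2)

universe u

/-! ### Two more facts about agreement of atlases -/

/-- **Agreement over `O` from agreement over `O ∩ S`, one-sided version**: it suffices that the
parts over `O` of the sources of the charts of the *first* atlas lie in `S` (`O`, `S` open).
[folklore] -/
theorem agreeOn_of_agreeOn_inter_left {X : Type*} [TopologicalSpace X] {H : Type*} [TopologicalSpace H]
    {G : StructureGroupoid H} {U V O S : Set X} {𝒜 : AtlasOn G U} {ℬ : AtlasOn G V}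
    (h : 𝒜.AgreeOn ℬ (O ∩ S)) (hO : IsOpen O) (hS : IsOpen S) (h𝒜 : ∀ e ∈ 𝒜.charts, e.source ∩ O ⊆ S) :
    𝒜.AgreeOn ℬ O := by
  intro e he e' he'
  obtain ⟨h1, h2⟩ := h e he e' he'
  refine ⟨G.mem_of_eqOnSource h1 ⟨?_, fun y _ => rfl⟩, ?_⟩
  · ext y
    simp only [trans_source, symm_source, mem_inter_iff, mem_preimage, restr_source' _ _ hO,
      restr_source' _ _ (hO.inter hS)]
    constructor
    · rintro ⟨hy, hy', hyO⟩; exact ⟨hy, hy', hyO, h𝒜 e he ⟨e.map_target hy, hyO⟩⟩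
    · rintro ⟨hy, hy', hyO, -⟩; exact ⟨hy, hy', hyO⟩
  · rwa [restr_inter_eq_restr_of_subset e (h𝒜 e he)] at h2

/-- **Agreement is insensitive to replacing charts by equivalent ones** (same source, same
values on it). [folklore] -/
theorem _root_.Literature.Geometry.Manifold.AtlasOn.AgreeOn.congr_right' {X : Type*} [TopologicalSpace X] {H : Type*} [TopologicalSpace H]
    {G : StructureGroupoid H} {U V₁ V₂ O : Set X} {𝒞 : AtlasOn G U} {ℬ₁ : AtlasOn G V₁} {ℬ₂ : AtlasOn G V₂}
    (h : 𝒞.AgreeOn ℬ₁ O) (H' : ∀ e₂ ∈ ℬ₂.charts, ∃ e₁ ∈ ℬ₁.charts, e₁ ≈ e₂) : 𝒞.AgreeOn ℬ₂ O := by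
  intro e he e₂ he₂
  obtain ⟨e₁, he₁, h12⟩ := H' e₂ he₂
  obtain ⟨h1, h2⟩ := h e he e₁ he₁
  exact ⟨G.mem_of_eqOnSource h1 (EqOnSource.trans' (Setoid.refl _) (EqOnSource.restr (Setoid.symm h12) O)),
    G.mem_of_eqOnSource h2 (EqOnSource.trans' (EqOnSource.symm' (Setoid.symm h12)) (Setoid.refl _))⟩

/-- The empty atlas. [folklore] -/
def _root_.Literature.Geometry.Manifold.AtlasOn.empty {X : Type*} [TopologicalSpace X] {H : Type*} [TopologicalSpace H]
    (G : StructureGroupoid H) : AtlasOn G (∅ : Set X) where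
  charts := ∅
  source_subset := by simp
  cover := by simp
  compatible := by simp

namespace SurfaceSmoothing

variable {M : Type u} [TopologicalSpace M] [T2Space M]

/-! ### The inductive step -/

/-- The part already covered before step `k`: the union of the unit discs of the charts with
index `< k`. [folklore] -/
def coreUnion (c : ℕ → Option (GoodChart M)) (k : ℕ) : Set M :=
  ⋃ j ∈ Finset.range k, ((c j).map fun g => g.disc 1).getD ∅

/-- The covered part is closed. [folklore] -/
theorem isClosed_coreUnion (c : ℕ → Option (GoodChart M)) (k : ℕ) : IsClosed (coreUnion c k) := by
  refine (Finset.range k).finite_toSet.isClosed_biUnion fun j _ => ?_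
  cases h : c j with
  | none => simp
  | some g => simpa using g.isClosed_disc (by norm_num : (1 : ℝ) ≤ 4)

omit [T2Space M] in
/-- The covered part at step `k + 1`. [folklore] -/
theorem coreUnion_succ (c : ℕ → Option (GoodChart M)) (k : ℕ) :
    coreUnion c (k + 1) = coreUnion c k ∪ ((c k).map fun g => g.disc 1).getD ∅ := by
  rw [coreUnion, coreUnion, Finset.range_add_one, Finset.set_biUnion_insert, union_comm]

omit [T2Space M] in
/-- The covered part is monotone. [folklore] -/
theorem coreUnion_mono (c : ℕ → Option (GoodChart M)) {k l : ℕ} (hkl : k ≤ l) : coreUnion c k ⊆ coreUnion c l :=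
  biUnion_subset_biUnion_left fun j hj => by
    simp only [Finset.coe_range, mem_Iio] at hj ⊢; exact hj.trans_le hkl

/-- **A stage of the induction**: a smooth atlas on an open part `N` of the surface containing
the part covered so far. [folklore] -/
structure Stage (c : ℕ → Option (GoodChart M)) (k : ℕ) where
  /-- The carrier. -/
  N : Set M
  /-- The atlas. -/
  𝒜 : AtlasOn planeGroupoid N
  /-- It contains the covered part. -/
  core_subset : coreUnion c k ⊆ N

/-- The region modified at step `k`: the disc of radius `3` of the `k`-th chart (empty if there
is none). [folklore] -/
def modified (c : ℕ → Option (GoodChart M)) (k : ℕ) : Set M := ((c k).map fun g => g.disc 3).getD ∅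

omit [T2Space M] in
/-- The modified region lies in the big disc. [folklore] -/
theorem modified_subset_big (c : ℕ → Option (GoodChart M)) (k : ℕ) :
    modified c k ⊆ ((c k).map fun g => g.disc 4).getD ∅ := by
  cases h : c k with
  | none => simp [modified, h]
  | some g => simpa [modified, h] using g.disc_mono (by norm_num : (3 : ℝ) ≤ 4) le_rfl

/-- **The inductive step of the smoothing**: given a smooth atlas on `N ⊇ coreUnion c k`, there is
one on a new open set containing `coreUnion c (k + 1)` which agrees with the old atlas off the
modified region — transport to the chart, apply the seam lemma `exists_planeAtlas_seam`, pull back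
and glue with the old atlas restricted off the disc of radius `3` (Moise, GTM 47, Ch. 8; Hatcher,
arXiv:1312.3518, proof of Thm. A). [folklore] -/
theorem step (c : ℕ → Option (GoodChart M)) (k : ℕ) (st : Stage c k) :
    ∃ st' : Stage c (k + 1), st'.𝒜.AgreeOn st.𝒜 (modified c k)ᶜ := by
  cases hck : c k with
  | none =>
    refine ⟨⟨st.N, st.𝒜, ?_⟩, ?_⟩
    · rw [coreUnion_succ, hck]; simpa using st.core_subset
    · show st.𝒜.AgreeOn st.𝒜 (modified c k)ᶜ
      rw [modified, hck]; simpa using AgreeOn.rfl isOpen_univ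
  | some g =>
    set φ := g.φ with hφ
    set N := st.N with hN
    set 𝒜 := st.𝒜 with h𝒜
    -- the structure read in the chart
    set W : Set ℂ := φ.symm.source ∩ φ.symm ⁻¹' N with hW
    set 𝒮 : PlaneAtlas W := 𝒜.pullback φ.symm with h𝒮
    have hWo : IsOpen W := 𝒮.isOpen
    set L' : Set ℂ := φ.target ∩ φ.symm ⁻¹' coreUnion c k with hL'
    have hL'W : L' ⊆ W := fun z hz => ⟨hz.1, st.core_subset hz.2⟩
    have hsph : sphere (0 : ℂ) 2 ⊆ φ.target :=
      (sphere_subset_closedBall.trans (closedBall_subset_closedBall (by norm_num))).trans g.closedBall_subset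
    have hC : IsClosed (L' ∩ sphere (0 : ℂ) 2) := by
      have : L' ∩ sphere 0 2 = sphere 0 2 ∩ φ.symm ⁻¹' coreUnion c k := by
        ext z; constructor
        · rintro ⟨⟨-, h⟩, hs⟩; exact ⟨hs, h⟩
        · rintro ⟨hs, h⟩; exact ⟨⟨hsph hs, h⟩, hs⟩
      rw [this]
      exact (φ.continuousOn_symm.mono hsph).preimage_isClosed_of_isClosed isClosed_sphere (isClosed_coreUnion c k)
    obtain ⟨W', 𝒮', h1, -, h3, h4, h5⟩ := exists_planeAtlas_seam 𝒮 hL'W hC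
    -- the new piece and the old piece
    set ℬ := 𝒮'.pullback φ with hℬ
    set C := g.disc 3 with hCdef
    have hCc : IsClosed C := g.isClosed_disc (by norm_num)
    set 𝒜' := 𝒜.restrict Cᶜ hCc.isOpen_compl with h𝒜'
    set O : Set M := φ.source ∩ φ ⁻¹' (W ∩ (closedBall (0 : ℂ) 3)ᶜ) with hO
    have hOo : IsOpen O := φ.isOpen_inter_preimage (hWo.inter isClosed_closedBall.isOpen_compl)
    have hOsub : O ⊆ N ∩ φ.source := fun y hy => by
      refine ⟨?_, hy.1⟩
      have := hy.2.1.2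
      rw [mem_preimage, φ.left_inv hy.1] at this
      exact this
    -- off the disc of radius 3, points over `W'` are over `W`
    have hkey : ∀ y ∈ φ.source, φ y ∈ W' → y ∉ C → y ∈ O := fun y hys hyW' hyC => by
      have hn3 := g.notMem_closedBall_of_notMem_disc (by norm_num) hys hyC
      refine ⟨hys, ?_, hn3⟩
      rcases h1 hyW' with h | h
      · exact h
      · exact absurd (ball_subset_closedBall h) hn3
    -- agreement of the new piece with the old atlas over `O`
    have a2 : ℬ.AgreeOn (𝒮.pullback φ) O :=
      (h5.pullback isClosed_closedBall.isOpen_compl φ).mono (φ.isOpen_inter_preimage isClosed_closedBall.isOpen_compl)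
        hOo fun y hy => ⟨hy.1, hy.2.2⟩
    have a3 : ℬ.AgreeOn (𝒜.restrict φ.source φ.open_source) O := by
      refine a2.congr_right' ?_
      rintro _ ⟨e, he, rfl⟩
      refine ⟨φ ≫ₕ (φ.symm ≫ₕ e), mem_image_of_mem (fun e' => φ ≫ₕ e')
        (show φ.symm ≫ₕ e ∈ 𝒮.charts from mem_image_of_mem (fun e' => φ.symm ≫ₕ e') he), ?_⟩
      show φ ≫ₕ (φ.symm ≫ₕ e) ≈ e.restr φ.source
      rw [← trans_assoc, ← ofSet_trans e φ.open_source]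
      exact EqOnSource.trans' φ.self_trans_symm (Setoid.refl e)
    have a4 : ℬ.AgreeOn 𝒜 O := by
      have := a3.trans (restrict_agreeOn 𝒜 φ.open_source hOo) hOo
      rwa [inter_eq_left.2 hOsub] at this
    have hagree : ℬ.AgreeOn 𝒜' O := by
      have := a4.trans (restrict_agreeOn 𝒜 hCc.isOpen_compl hOo).symm hOo
      rwa [inter_eq_left.2 (hOsub.trans inter_subset_left)] at this
    have hUV : φ.source ∩ φ ⁻¹' W' ∩ (N ∩ Cᶜ) ⊆ O := by
      rintro y ⟨⟨hys, hyW'⟩, -, hyC⟩; exact hkey y hys hyW' hyC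
    set 𝒜new := ℬ.union 𝒜' hagree hOo hUV with h𝒜new
    refine ⟨⟨_, 𝒜new, ?_⟩, ?_⟩
    · -- the covered part at step `k + 1`
      rw [coreUnion_succ, hck]
      rintro y (hy | hy)
      · by_cases hyC : y ∈ C
        · have hys : y ∈ φ.source := g.disc_subset_source (by norm_num) hyC
          refine Or.inl ⟨hys, h4 ⟨φ.map_source hys, ?_⟩⟩
          show φ.symm (φ y) ∈ coreUnion c k
          rw [φ.left_inv hys]; exact hy
        · exact Or.inr ⟨st.core_subset hy, hyC⟩
      · simp only [Option.map_some, Option.getD_some] at hy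
        rw [g.mem_disc_iff (by norm_num)] at hy
        exact Or.inl ⟨hy.1, h3 (closedBall_subset_ball (by norm_num) hy.2)⟩
    · -- agreement with the old atlas off the modified region
      show 𝒜new.AgreeOn 𝒜 (modified c k)ᶜ
      rw [modified, hck]
      simp only [Option.map_some, Option.getD_some]
      refine (agreeOn_union_iff.2 ⟨?_, (restrict_agreeOn 𝒜 hCc.isOpen_compl hCc.isOpen_compl).symm⟩).symm
      refine (agreeOn_of_agreeOn_inter_left (a4.mono hOo (hCc.isOpen_compl.inter hOo) inter_subset_right)
        hCc.isOpen_compl hOo fun e he => ?_).symm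
      rintro y ⟨hye, hyC⟩
      have := ℬ.source_subset e he hye
      exact hkey y this.1 this.2 hyC

/-! ### The sequence of stages and its limit -/

/-- **The stages of the smoothing induction** (by recursion, choosing a step at each index).
[folklore] -/
def stage (c : ℕ → Option (GoodChart M)) : ∀ k, Stage c k
  | 0 => ⟨∅, AtlasOn.empty planeGroupoid, by simp [coreUnion]⟩
  | k + 1 => (step c k (stage c k)).choose

/-- Consecutive stages agree off the modified region. [folklore] -/
theorem stage_succ_agreeOn (c : ℕ → Option (GoodChart M)) (k : ℕ) :
    (stage c (k + 1)).𝒜.AgreeOn (stage c k).𝒜 (modified c k)ᶜ :=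
  (step c k (stage c k)).choose_spec

/-- **Stages agree over an open set which avoids the intermediate modified regions and lies in
the intermediate carriers.** [folklore] -/
theorem stage_agreeOn (c : ℕ → Option (GoodChart M)) {V : Set M} (hV : IsOpen V) (n : ℕ) :
    ∀ m, n ≤ m → (∀ j, n ≤ j → j < m → Disjoint V (modified c j)) → (∀ j, n ≤ j → j ≤ m → V ⊆ (stage c j).N) →
      (stage c m).𝒜.AgreeOn (stage c n).𝒜 V := by
  intro m hnm
  induction m, hnm using Nat.le_induction with
  | base => exact fun _ _ => AgreeOn.rfl hV
  | succ m hnm ih =>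
    intro hdisj hsub
    have h1 := ih (fun j hj hjm => hdisj j hj (Nat.lt_succ_of_lt hjm)) (fun j hj hjm => hsub j hj (Nat.le_succ_of_le hjm))
    have h2 : (stage c (m + 1)).𝒜.AgreeOn (stage c m).𝒜 V :=
      (stage_succ_agreeOn c m).mono (by
        rw [modified]; cases c m with
        | none => simp
        | some g => simpa using (g.isClosed_disc (by norm_num : (3 : ℝ) ≤ 4)).isOpen_compl) hV
        (fun y hy => Set.disjoint_left.1 (hdisj m hnm (Nat.lt_succ_self m)) hy)
    have h3 := h2.trans h1 hV
    rwa [inter_eq_left.2 (hsub m hnm (Nat.le_succ m))] at h3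

/-- **The glued smooth atlas on the whole surface.** [folklore] -/
theorem exists_atlasOn_univ [SecondCountableTopology M] [ChartedSpace 𝔼₂ M] :
    Nonempty (AtlasOn planeGroupoid (univ : Set M)) := by
  classical
  obtain ⟨c, hcov, hlf⟩ := exists_seq_goodChart (M := M)
  choose kf gf hcg hyg using hcov
  have hlf' : ∀ y : M, ∃ t ∈ 𝓝 y, {k | ((((c k).map fun g => g.disc 4).getD ∅) ∩ t).Nonempty}.Finite := hlf
  choose tf htf hfin using hlf'
  -- the stabilisation index and the neighbourhood at `y`
  set n : M → ℕ := fun y => (hfin y).toFinset.sup id + kf y + 1 with hn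
  set V : M → Set M := fun y => (gf y).inner ∩ interior (tf y) with hVdef
  have hVo : ∀ y, IsOpen (V y) := fun y => (gf y).isOpen_inner.inter isOpen_interior
  have hyV : ∀ y, y ∈ V y := fun y => ⟨hyg y, mem_interior_iff_mem_nhds.2 (htf y)⟩
  have hn_big : ∀ y, ∀ j, n y ≤ j → Disjoint (V y) (modified c j) := by
    intro y j hj
    refine Set.disjoint_left.2 fun w hw hw' => ?_
    have hmem : j ∈ (hfin y).toFinset := by
      rw [Set.Finite.mem_toFinset]
      exact ⟨w, modified_subset_big c j hw', interior_subset hw.2⟩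
    have h1 := Finset.le_sup (f := id) hmem
    simp only [id_eq] at h1
    have h2 : j < n y := by
      show j < (hfin y).toFinset.sup id + kf y + 1
      omega
    omega
  have hn_sub : ∀ y, ∀ j, n y ≤ j → V y ⊆ (stage c j).N := by
    intro y j hj w hw
    apply (stage c j).core_subset
    have hk : kf y < j := by
      have : kf y < n y := by
        show kf y < (hfin y).toFinset.sup id + kf y + 1
        omega
      omega
    refine coreUnion_mono c (Nat.succ_le_of_lt hk) ?_
    rw [coreUnion_succ, hcg y]
    simp only [Option.map_some, Option.getD_some]
    exact Or.inr ((gf y).inner_subset_disc_one hw.1)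
  have hagree : ∀ y ∈ (univ : Set M), ∀ i, n y ≤ i → (stage c i).𝒜.AgreeOn (stage c (n y)).𝒜 (V y) := fun y _ i hi =>
    stage_agreeOn c (hVo y) (n y) i hi (fun j hj _ => hn_big y j hj) (fun j hj _ => hn_sub y j hj)
  set ℒ := AtlasOn.limit (fun k => (stage c k).𝒜) n V (fun y _ => hVo y) (fun y _ i hi => hn_sub y i hi) hagree with hℒ
  have hU : (⋃ y ∈ (univ : Set M), V y) = univ := eq_univ_of_forall fun y => mem_iUnion₂.2 ⟨y, mem_univ y, hyV y⟩
  exact ⟨ℒ.copy hU⟩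

end SurfaceSmoothing

/-! ### Every topological surface admits a smooth structure -/

/-- **Every topological surface admits a smooth structure** (T. Radó, *Über den Begriff der
Riemannschen Fläche*, Acta Sci. Math. Szeged 2 (1925); the `n = 2` clause of the existence half of
A. Juhász, *Differential and Low-Dimensional Topology* (2023), Thm. 1.33; E. E. Moise, *Geometric
topology in dimensions 2 and 3* (1977), Ch. 8; A. Hatcher, arXiv:1312.3518, Thm. A): a Hausdorff
second countable space locally homeomorphic to `ℝ²` carries a `C^∞`-compatible atlas.

Proof (chart-by-chart, as in Hatcher's proof of Thm. A and Moise Ch. 8): cover the surface by a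
locally finite sequence of good topological charts (`SurfaceSmoothing.exists_seq_goodChart`);
inductively extend a smooth atlas over the unit disc of the next chart, modifying it only inside
that chart's disc of radius `3` — in the chart this is the seam lemma `exists_planeAtlas_seam`
(straightening by the annulus theorem off the already smoothed part, or capping an exotic
annulus by an essential level circle of a proper Morse function); by local finiteness the
atlases stabilise near every point and glue (`AtlasOn.limit`). [cite: Juhasz2023, Thm. 1.33 (existence, n = 2)] -/
theorem exists_chartedSpace_isManifold_two (M : Type u) [TopologicalSpace M] [T2Space M]
    [SecondCountableTopology M] [ChartedSpace (EuclideanSpace ℝ (Fin 2)) M] :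
    ∃ c : ChartedSpace (EuclideanSpace ℝ (Fin 2)) M, @IsManifold ℝ _ _ _ _ _ _ (𝓡 2) ∞ M _ c := by
  obtain ⟨ℒ⟩ := SurfaceSmoothing.exists_atlasOn_univ (M := M)
  exact ⟨ℒ.chartedSpace, @IsManifold.mk' ℝ _ _ _ _ _ _ (𝓡 2) ∞ M _ ℒ.chartedSpace ℒ.hasGroupoid⟩

/-- **The smoothing fact in dimensions `≤ 3` reduces to Moise's theorem** (its case `n = 3`):
with the leaves `n = 0, 1` of the tree and `n = 2` above, the named fact
`exists_chartedSpace_isManifold_of_le_three` follows from the smoothability of topological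
`3`-manifolds alone (E. E. Moise, Ann. of Math. 56 (1952); stated here in the fact's own shape as
a hypothesis, not as a new fact). [cite: Juhasz2023, Thm. 1.33] -/
theorem exists_chartedSpace_isManifold_of_le_three_of_three
    (h₃ : ∀ (M : Type u) [TopologicalSpace M] [T2Space M] [SecondCountableTopology M]
      [ChartedSpace (EuclideanSpace ℝ (Fin 3)) M],
      ∃ c : ChartedSpace (EuclideanSpace ℝ (Fin 3)) M, @IsManifold ℝ _ _ _ _ _ _ (𝓡 3) ∞ M _ c) :
    exists_chartedSpace_isManifold_of_le_three.{u} :=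
  exists_chartedSpace_isManifold_of_le_three_of_two_three (fun M _ _ _ _ => exists_chartedSpace_isManifold_two M) h₃

end Literature.Topology.FourManifolds

end
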